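import Summits.Ventures.Crystal3D.Theorems.StickyWulffConstantCoaxialWallLawHealCapTen
import HarnessLib

/-!
# Cap-table row «HEXAGON − 1 + lower triple» (eight occupied slots): at most THREE junk contacts (crux `CoaxialWallLaw`, stmt-Ventures-19481;
# line `WallLedgerF`, skeleton 'CoaxialWallLawCertificates' v8.1, input `JunkCapBound` of `…SeamIncoherentAssembly`)

HONEST FRAMING. Venture `Summits/Ventures/Crystal3D` (cell `crystal3d-full`); one cap-table row for the crux `CoaxialWallLaw` (stmt-Ventures-19481,
`route-Ventures-StickyWulffConstant`), lane F T5b.  Nothing about the stubs is claimed; F-C1 not moved.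
THE FACT (structural, no numerics): let a core ball `y` have, in a frame `L`, its lower triple `{1,5,11}` and five of its six hexagon slots in the core, the hexagon
slot `0 = (1,1,0)/√2` being EMPTY.  A junk contact direction `u` (unit, inner product `≤ 1/2` with the eight occupied slots) is either
* in the TONGUE `⟪u, slot 0⟫ > 1/2` (the region opened by the empty slot: a thin horn rising from the slot position to the hexagon edge between the two hollows
  over slot `0`), or
* HEAL-FREE (`…HealCap.HealFree`: inner product `≤ 1/2` with all nine slots of the closed lower half-dozen).
`HealCap.tongue_inner`: two tongue directions make inner product `> 1/2` (adapted coordinates depth/transverse/axial; the axial component is non-negative on the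
tongue and `≥ 2√(depth)`; a one-line polynomial certificate) ⇒ at most ONE junk ball in the tongue.  Three `1`-separated heal-free junk directions are three
tips (`healFree_three`); a tip other than the two hollows over slot `0` (the upper slot `8` and the basal mirror of the lower slot `5`) caps a CORE triangle
(`capsTriangleIn_of_tip_off_zero`), which closure maximality forbids for a junk ball; so three heal-free junk directions would be three values in a two-element
set — two coincide.  Hence at most `1 + 2 = 3`:
* `HealCap.tongue_axial`, `HealCap.tongue_core`, `HealCap.tongue_inner` (real variables); `TongueDir`, `inner_gt_half_of_tongue` (vector form);
* `healTip_triangle_off_zero`, `capsTriangleIn_of_tip_off_zero`; `inner_le_half_of_occupied` (a contact direction vs an occupied slot);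
* **`junk_contacts_le_three_of_hexFive`** — the row; `HexFivePat`, and the row as the statement `JunkCapBound`-instances are made of (the instance itself is one
  line of `…SeamJunkCapTable.junkCapBound_patternCap`, filed there once that module is in the tree).
By the `C₃ᵥ` symmetry of the closed lower half-dozen every «one hexagon slot empty» pattern is this one in a suitable frame (the certificate side picks the frame).
-/

noncomputable section

namespace Summit.Ventures.Crystal3D.Theorems

namespace TailResidue

open Summit.Ventures.Crystal3D Finset NearIdentity
open Literature.MathematicalPhysics.StatisticalMechanics (basalMirror)
open scoped InnerProductSpace

namespace HealCap

/-! ### Real-variable core: the tongue -/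

/-- Axial step of the tongue lemma: with depth `0 ≤ A < c`, transverse `Y² ≤ A²` and `W ≥ −A`, the identity `W² = 6cA − (3/2)A² − Y²/2` forces `W ≥ 0` and
`W² ≥ 4cA`. -/
theorem tongue_axial {c A Y W : ℝ} (hc0 : 0 < c) (hA0 : 0 ≤ A) (hAc : A < c) (hYsq : Y ^ 2 ≤ A ^ 2) (hWA : -A ≤ W)
    (hW2 : W ^ 2 = 6 * c * A - 3 / 2 * A ^ 2 - Y ^ 2 / 2) : 0 ≤ W ∧ 4 * c * A ≤ W ^ 2 := by
  have hAcA : A ^ 2 ≤ c * A := by nlinarith [mul_nonneg hA0 (sub_nonneg.2 hAc.le)]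
  refine ⟨?_, by nlinarith⟩
  by_contra hneg
  push Not at hneg
  have h1 : W ^ 2 ≤ A ^ 2 := by nlinarith [mul_nonneg (neg_nonneg.2 hneg.le) (show 0 ≤ W + A by linarith)]
  have hA00 : A = 0 := by nlinarith
  have hY0 : Y ^ 2 ≤ 0 := by rw [hA00] at hYsq; simpa using hYsq
  have : W ^ 2 ≤ 0 := by rw [hW2, hA00]; nlinarith
  nlinarith

/-- Final step of the tongue lemma in adapted coordinates (depths `A, B < c`, transverse `Y, Y'`, axial `W, W' ≥ 0` with `W² ≥ 4cA`, `W'² ≥ 4cB`):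
`1 − c(A+B) + AB/2 + YY'/6 + WW'/3 > 1/2` (certificate `16αβ − 9δ² = 8α(1−2α) + 7αδ + 9δ(1/2−β)` in the normalised depths `α = cA`, `β = cB`, `δ = α+β−1/2`). -/
theorem tongue_core {c A B Y Y' W W' : ℝ} (hc : c ^ 2 = 1 / 2) (hc0 : 0 < c) (hA0 : 0 ≤ A) (hAc : A < c) (hB0 : 0 ≤ B) (hBc : B < c)
    (hYY : -(A * B) ≤ Y * Y') (hW0 : 0 ≤ W) (hW0' : 0 ≤ W') (hWlow : 4 * c * A ≤ W ^ 2) (hWlow' : 4 * c * B ≤ W' ^ 2) :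
    1 / 2 < 1 - c * (A + B) + A * B / 2 + Y * Y' / 6 + W * W' / 3 := by
  set R := c * (A + B) - 1 / 2 - A * B / 3 with hR
  suffices hWW : R < W * W' / 3 by linarith
  have hWW0 : 0 ≤ W * W' := mul_nonneg hW0 hW0'
  by_cases hR0 : R < 0
  · linarith
  push Not at hR0
  have hprod : 8 * (A * B) ≤ (W * W') ^ 2 := by
    have h1 : 4 * c * A * (4 * c * B) ≤ W ^ 2 * W' ^ 2 := mul_le_mul hWlow hWlow' (by positivity) (sq_nonneg W)
    have h2 : 4 * c * A * (4 * c * B) = 8 * (A * B) := by linear_combination (16 * (A * B)) * hc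
    have h3 : (W * W') ^ 2 = W ^ 2 * W' ^ 2 := by ring
    linarith
  set δ := c * (A + B) - 1 / 2 with hδ
  have hδR : R ≤ δ := by simp only [hR, hδ]; linarith [mul_nonneg hA0 hB0]
  have hδ0 : 0 ≤ δ := hR0.trans hδR
  have hcA : c * A < 1 / 2 := by nlinarith [mul_lt_mul_of_pos_left hAc hc0]
  have hcB : c * B < 1 / 2 := by nlinarith [mul_lt_mul_of_pos_left hBc hc0]
  have hαpos : 0 < c * A := by simp only [hδ] at hδ0; linarith
  have hkey : 9 * δ ^ 2 < 8 * (A * B) := by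
    have e : 8 * (A * B) - 9 * δ ^ 2 = 8 * (c * A) * (1 - 2 * (c * A)) + 7 * (c * A) * δ + 9 * δ * (1 / 2 - c * B) := by
      simp only [hδ]; linear_combination (-16 * (A * B)) * hc
    nlinarith [mul_pos hαpos (show 0 < 1 - 2 * (c * A) by linarith), mul_nonneg hαpos.le hδ0,
      mul_nonneg hδ0 (show 0 ≤ 1 / 2 - c * B by linarith)]
  have hR2 : (3 * R) ^ 2 < (W * W') ^ 2 := by
    have h1 : R ^ 2 ≤ δ ^ 2 := by nlinarith [mul_nonneg hR0 hδ0]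
    nlinarith [hprod, hkey, h1]
  have h3R : 3 * R < W * W' := lt_of_pow_lt_pow_left₀ 2 hWW0 hR2
  linarith

/-- **TONGUE**: two unit directions (cubic coordinates `(a,b,d)`, `(a',b',d')`; `c = √2/2`) at inner product `≤ 1/2` with the slots `4 = (1,0,1)`, `9 = (0,1,−1)`,
`5 = (1,0,−1)` (the two hexagon neighbours and the lower neighbour of the hexagon slot `0 = (1,1,0)`) and at inner product `> 1/2` with slot `0` make inner
product `> 1/2` with each other — the region opened by an EMPTY hexagon slot holds at most one ball of a `1`-separated family. -/
theorem tongue_inner {c a b d a' b' d' : ℝ} (hc : c ^ 2 = 1 / 2) (hc0 : 0 < c)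
    (hn : a ^ 2 + b ^ 2 + d ^ 2 = 1) (hn' : a' ^ 2 + b' ^ 2 + d' ^ 2 = 1)
    (h4 : a + d ≤ c) (h9 : b - d ≤ c) (h5 : a - d ≤ c) (h0 : c < a + b)
    (h4' : a' + d' ≤ c) (h9' : b' - d' ≤ c) (h5' : a' - d' ≤ c) (h0' : c < a' + b') :
    1 / 2 < a * a' + b * b' + d * d' := by
  -- adapted coordinates: depth `A = 2c − (a+b)`, transverse `Y = (a−b) + 2d`, axial `W = d − (a−b)`
  have hsum : a + b ≤ 2 * c := by
    have h1 : (a + b) ^ 2 ≤ (2 * c) ^ 2 := by nlinarith [sq_nonneg (a - b), sq_nonneg d]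
    exact (abs_le_of_sq_le_sq' h1 (by positivity)).2
  have hsum' : a' + b' ≤ 2 * c := by
    have h1 : (a' + b') ^ 2 ≤ (2 * c) ^ 2 := by nlinarith [sq_nonneg (a' - b'), sq_nonneg d']
    exact (abs_le_of_sq_le_sq' h1 (by positivity)).2
  have hW2 : (d - (a - b)) ^ 2 = 6 * c * (2 * c - (a + b)) - 3 / 2 * (2 * c - (a + b)) ^ 2 - ((a - b) + 2 * d) ^ 2 / 2 := by
    linear_combination 3 * hn - 6 * hc
  have hW2' : (d' - (a' - b')) ^ 2 = 6 * c * (2 * c - (a' + b')) - 3 / 2 * (2 * c - (a' + b')) ^ 2 - ((a' - b') + 2 * d') ^ 2 / 2 := by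
    linear_combination 3 * hn' - 6 * hc
  have hYsq : ((a - b) + 2 * d) ^ 2 ≤ (2 * c - (a + b)) ^ 2 := by
    nlinarith [mul_nonneg (show 0 ≤ 2 * c - (a + b) - ((a - b) + 2 * d) by linarith) (show 0 ≤ 2 * c - (a + b) + ((a - b) + 2 * d) by linarith)]
  have hYsq' : ((a' - b') + 2 * d') ^ 2 ≤ (2 * c - (a' + b')) ^ 2 := by
    nlinarith [mul_nonneg (show 0 ≤ 2 * c - (a' + b') - ((a' - b') + 2 * d') by linarith)
      (show 0 ≤ 2 * c - (a' + b') + ((a' - b') + 2 * d') by linarith)]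
  obtain ⟨hW0, hWlow⟩ := tongue_axial hc0 (by linarith) (by linarith) hYsq (by linarith) hW2
  obtain ⟨hW0', hWlow'⟩ := tongue_axial hc0 (by linarith) (by linarith) hYsq' (by linarith) hW2'
  have hYY : -((2 * c - (a + b)) * (2 * c - (a' + b'))) ≤ ((a - b) + 2 * d) * ((a' - b') + 2 * d') := by
    nlinarith [mul_nonneg (show 0 ≤ 2 * c - (a + b) - ((a - b) + 2 * d) by linarith) (show 0 ≤ 2 * c - (a' + b') - ((a' - b') + 2 * d') by linarith),
      mul_nonneg (show 0 ≤ 2 * c - (a + b) + ((a - b) + 2 * d) by linarith) (show 0 ≤ 2 * c - (a' + b') + ((a' - b') + 2 * d') by linarith)]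
  have key := tongue_core hc hc0 (by linarith) (by linarith) (by linarith) (by linarith) hYY hW0 hW0' hWlow hWlow'
  have hip : a * a' + b * b' + d * d' =
      1 - c * ((2 * c - (a + b)) + (2 * c - (a' + b'))) + (2 * c - (a + b)) * (2 * c - (a' + b')) / 2 +
        ((a - b) + 2 * d) * ((a' - b') + 2 * d') / 6 + (d - (a - b)) * (d' - (a' - b')) / 3 := by linear_combination 2 * hc
  rw [hip]; exact key

end HealCap

/-! ### Vector form -/

/-- A TONGUE DIRECTION of the pattern: a unit vector at inner product `≤ 1/2` with the slots `4, 9` (hexagon neighbours of slot `0`) and `5` (the lower slot adjacent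
to slot `0`) and at inner product `> 1/2` with the (empty) hexagon slot `0`. -/
def TongueDir (u : EuclideanSpace ℝ (Fin 3)) : Prop :=
  ‖u‖ = 1 ∧ ⟪u, slotSite 4⟫_ℝ ≤ 1 / 2 ∧ ⟪u, slotSite 9⟫_ℝ ≤ 1 / 2 ∧ ⟪u, slotSite 5⟫_ℝ ≤ 1 / 2 ∧ 1 / 2 < ⟪u, slotSite 0⟫_ℝ

/-- `(√2/2)² = 1/2`. -/
private theorem c_sq' : (Real.sqrt 2 / 2) ^ 2 = 1 / 2 := by
  have h2 : Real.sqrt 2 ^ 2 = 2 := Real.sq_sqrt (by norm_num)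
  nlinarith

/-- A slot constraint in cubic coordinates. -/
private theorem slot_le {u : EuclideanSpace ℝ (Fin 3)} (k : Fin 12) (h : ⟪u, slotSite k⟫_ℝ ≤ 1 / 2) :
    cubicCoords u 0 * slotInt k 0 + cubicCoords u 1 * slotInt k 1 + cubicCoords u 2 * slotInt k 2 ≤ Real.sqrt 2 / 2 := by
  have hs : 0 < Real.sqrt 2 := by positivity
  rw [inner_slotSite_right, div_le_iff₀ hs] at h
  linarith

/-- **Two tongue directions make inner product `> 1/2`.** -/
theorem inner_gt_half_of_tongue {u u' : EuclideanSpace ℝ (Fin 3)} (h : TongueDir u) (h' : TongueDir u') : 1 / 2 < ⟪u, u'⟫_ℝ := by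
  obtain ⟨hn, h4, h9, h5, h0⟩ := h
  obtain ⟨hn', h4', h9', h5', h0'⟩ := h'
  have hs : 0 < Real.sqrt 2 := by positivity
  have e4 := slot_le 4 h4; have e9 := slot_le 9 h9; have e5 := slot_le 5 h5
  have e4' := slot_le 4 h4'; have e9' := slot_le 9 h9'; have e5' := slot_le 5 h5'
  have e0 : Real.sqrt 2 / 2 < cubicCoords u 0 * slotInt 0 0 + cubicCoords u 1 * slotInt 0 1 + cubicCoords u 2 * slotInt 0 2 := by
    rw [inner_slotSite_right, lt_div_iff₀ hs] at h0; linarith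
  have e0' : Real.sqrt 2 / 2 < cubicCoords u' 0 * slotInt 0 0 + cubicCoords u' 1 * slotInt 0 1 + cubicCoords u' 2 * slotInt 0 2 := by
    rw [inner_slotSite_right, lt_div_iff₀ hs] at h0'; linarith
  simp only [slotInt, Matrix.cons_val_zero, Matrix.cons_val_one, Matrix.cons_val] at e4 e9 e5 e4' e9' e5' e0 e0'
  norm_num at e4 e9 e5 e4' e9' e5' e0 e0'
  rw [inner_eq_cubicCoords_three]
  exact HealCap.tongue_inner c_sq' (by positivity) (cubicCoords_sq_sum hn) (cubicCoords_sq_sum hn') (by linarith) (by linarith) (by linarith)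
    (by linarith) (by linarith) (by linarith) (by linarith) (by linarith)

/-! ### The four tips that cap occupied triangles -/

/-- Cubic coordinates of the slots (`c = √2/2`). -/
private theorem cc_slot' (k : Fin 12) (i : Fin 3) : cubicCoords (slotSite k) i = (slotInt k i : ℝ) / Real.sqrt 2 := by
  rw [cubicCoords_slotSite]; rfl

/-- Cubic coordinates of the basal mirror of a slot. -/
private theorem cc_mirror' (k : Fin 12) :
    cubicCoords (basalMirror (slotSite k)) =
      ![((slotInt k 0 : ℝ) + 2 * slotInt k 1 + 2 * slotInt k 2) / 3 / Real.sqrt 2,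
        (2 * (slotInt k 0 : ℝ) + slotInt k 1 - 2 * slotInt k 2) / 3 / Real.sqrt 2,
        (2 * (slotInt k 0 : ℝ) - 2 * slotInt k 1 + slotInt k 2) / 3 / Real.sqrt 2] := by
  rw [cubicCoords_basalMirror]
  ext i; fin_cases i <;> simp [cc_slot'] <;> ring

/-- **The tips other than the two hollows over slot `0` cap triangles avoiding slot `0`**: for `t ∈ healTips`, `t ≠ slotSite 8`, `t ≠ basalMirror (slotSite 5)`,
there are two ADJACENT slots `a, b ∈ lowerNine ∖ {0}` with `t` at distance `1` from both. -/
theorem healTip_triangle_off_zero {t : EuclideanSpace ℝ (Fin 3)} (ht : t ∈ healTips) (h8 : t ≠ slotSite 8) (hm5 : t ≠ basalMirror (slotSite 5)) :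
    ∃ a ∈ lowerNine, ∃ b ∈ lowerNine, a ≠ 0 ∧ b ≠ 0 ∧ dist (slotSite a) (slotSite b) = 1 ∧ dist t (slotSite a) = 1 ∧ dist t (slotSite b) = 1 := by
  have h2 : Real.sqrt 2 ^ 2 = 2 := Real.sq_sqrt (by norm_num)
  have hs : Real.sqrt 2 ≠ 0 := by positivity
  simp only [healTips, mem_insert, mem_singleton] at ht
  rcases ht with rfl | rfl | rfl | rfl | rfl | rfl
  · exact ⟨9, by decide, 7, by decide, by decide, by decide, dist_slotSite_slotSite_eq_one (by decide), dist_slotSite_slotSite_eq_one (by decide),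
      dist_slotSite_slotSite_eq_one (by decide)⟩
  · exact ⟨3, by decide, 10, by decide, by decide, by decide, dist_slotSite_slotSite_eq_one (by decide), dist_slotSite_slotSite_eq_one (by decide),
      dist_slotSite_slotSite_eq_one (by decide)⟩
  · exact absurd rfl h8
  · refine ⟨4, by decide, 10, by decide, by decide, by decide, dist_slotSite_slotSite_eq_one (by decide), ?_, ?_⟩ <;>
      apply dist_eq_one_of_cubicCoords <;> simp only [cc_mirror', cc_slot', slotInt, Matrix.cons_val_zero, Matrix.cons_val_one, Matrix.cons_val] <;>
      norm_num <;> field_simp <;> nlinarith [h2]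
  · exact absurd rfl hm5
  · refine ⟨3, by decide, 7, by decide, by decide, by decide, dist_slotSite_slotSite_eq_one (by decide), ?_, ?_⟩ <;>
      apply dist_eq_one_of_cubicCoords <;> simp only [cc_mirror', cc_slot', slotInt, Matrix.cons_val_zero, Matrix.cons_val_one, Matrix.cons_val] <;>
      norm_num <;> field_simp <;> nlinarith [h2]

/-- A ball at such a tip of a core ball whose eight slots (pattern «hexagon − slot 0 + lower triple») lie in the core CAPS A CORE TRIANGLE. -/
theorem capsTriangleIn_of_tip_off_zero {D : Finset (EuclideanSpace ℝ (Fin 3))} (L : EuclideanSpace ℝ (Fin 3) ≃ₗᵢ[ℝ] EuclideanSpace ℝ (Fin 3))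
    {y : EuclideanSpace ℝ (Fin 3)} (hy : y ∈ D) (hocc : ∀ k ∈ lowerNine, k ≠ 0 → y + L (slotSite k) ∈ D) {t : EuclideanSpace ℝ (Fin 3)} (ht : t ∈ healTips)
    (h8 : t ≠ slotSite 8) (hm5 : t ≠ basalMirror (slotSite 5)) : CapsTriangleIn D (y + L t) := by
  obtain ⟨a, ha, b, hb, ha0, hb0, hab, hta, htb⟩ := healTip_triangle_off_zero ht h8 hm5
  refine ⟨y, hy, y + L (slotSite a), hocc a ha ha0, y + L (slotSite b), hocc b hb hb0, dist_slotSite_eq_one L y (slotSite_mem a),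
    dist_slotSite_eq_one L y (slotSite_mem b), ?_, ?_, ?_, ?_⟩
  · rw [dist_eq_norm, add_sub_add_left_eq_sub, ← map_sub, LinearIsometryEquiv.norm_map, ← dist_eq_norm, hab]
  · rw [dist_comm]
    have hn : ‖t‖ = 1 := by
      simp only [healTips, mem_insert, mem_singleton] at ht
      rcases ht with rfl | rfl | rfl | rfl | rfl | rfl <;>
        first
        | exact norm_eq_one_of_mem_fccSlots (slotSite_mem _)
        | (rw [LinearIsometryEquiv.norm_map]; exact norm_eq_one_of_mem_fccSlots (slotSite_mem _))
    rw [dist_eq_norm, show y - (y + L t) = -(L t) by abel, norm_neg, LinearIsometryEquiv.norm_map, hn]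
  · rw [dist_eq_norm, add_sub_add_left_eq_sub, ← map_sub, LinearIsometryEquiv.norm_map, ← dist_eq_norm, hta]
  · rw [dist_eq_norm, add_sub_add_left_eq_sub, ← map_sub, LinearIsometryEquiv.norm_map, ← dist_eq_norm, htb]

/-! ### Packing form: the row -/

/-- **A contact direction makes inner product `≤ 1/2` with every OCCUPIED unit slot** (transported to the model frame). -/
theorem inner_le_half_of_occupied {X : Finset (EuclideanSpace ℝ (Fin 3))} (hX : ∀ p ∈ X, ∀ q ∈ X, p ≠ q → 1 ≤ dist p q)
    (L : EuclideanSpace ℝ (Fin 3) ≃ₗᵢ[ℝ] EuclideanSpace ℝ (Fin 3)) {y x s : EuclideanSpace ℝ (Fin 3)} (hs : ‖s‖ = 1) (hocc : y + L s ∈ X) (hx : x ∈ X)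
    (hd : dist y x = 1) (hne : x ≠ y + L s) : ⟪L.symm (x - y), s⟫_ℝ ≤ 1 / 2 := by
  have hxy : ‖x - y‖ = 1 := by rw [← dist_eq_norm, dist_comm]; exact hd
  have h1 : ⟪L.symm (x - y), s⟫_ℝ = ⟪x - y, L s⟫_ℝ := by
    rw [← L.inner_map_map (L.symm (x - y)) s, LinearIsometryEquiv.apply_symm_apply]
  rw [h1]
  refine inner_le_half_of_norm_sub_ge_one hxy (by rw [LinearIsometryEquiv.norm_map]; exact hs) ?_
  have : x - y - L s = x - (y + L s) := by abel
  rw [this, ← dist_eq_norm]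
  exact hX x hx _ hocc hne

/-- Two distinct contacts of `y` make inner product `≤ 1/2` (transported). -/
theorem inner_le_half_of_contacts {X : Finset (EuclideanSpace ℝ (Fin 3))} (hX : ∀ p ∈ X, ∀ q ∈ X, p ≠ q → 1 ≤ dist p q)
    (L : EuclideanSpace ℝ (Fin 3) ≃ₗᵢ[ℝ] EuclideanSpace ℝ (Fin 3)) {y p q : EuclideanSpace ℝ (Fin 3)} (hp : p ∈ X) (hq : q ∈ X) (hpq : p ≠ q)
    (hdp : dist y p = 1) (hdq : dist y q = 1) : ⟪L.symm (p - y), L.symm (q - y)⟫_ℝ ≤ 1 / 2 := by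
  rw [L.symm.inner_map_map]
  refine inner_le_half_of_norm_sub_ge_one (by rw [← dist_eq_norm, dist_comm]; exact hdp) (by rw [← dist_eq_norm, dist_comm]; exact hdq) ?_
  have : p - y - (q - y) = p - q := by abel
  rw [this, ← dist_eq_norm]; exact hX p hp q hq hpq

open scoped Classical in
/-- **ROW «hexagon − 1 + lower triple ⇒ ≤ 3»**: a core ball `y` within `2` of the payer whose positions over the lower triple and over five of the six hexagon
slots of a frame `L` (slot `0` excepted) are CORE balls is touched by at most three balls outside the core. -/
theorem junk_contacts_le_three_of_hexFive {X : Finset (EuclideanSpace ℝ (Fin 3))} (hX : ∀ p ∈ X, ∀ q ∈ X, p ≠ q → 1 ≤ dist p q)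
    {z : EuclideanSpace ℝ (Fin 3)} (S : EuclideanSpace ℝ (Fin 3) ≃ₗᵢ[ℝ] EuclideanSpace ℝ (Fin 3)) {y : EuclideanSpace ℝ (Fin 3)}
    (hy : y ∈ coreOf X z S) (hzy : dist z y ≤ 2) (L : EuclideanSpace ℝ (Fin 3) ≃ₗᵢ[ℝ] EuclideanSpace ℝ (Fin 3))
    (hocc : ∀ k ∈ lowerNine, k ≠ 0 → y + L (slotSite k) ∈ coreOf X z S) :
    ((X \ coreOf X z S).filter fun x => dist y x = 1).card ≤ 3 := by
  set D := coreOf X z S with hD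
  have hDX : D ⊆ X := coreOf_subset X z S
  set J := (X \ D).filter fun x => dist y x = 1 with hJ
  -- facts about a junk contact
  have hJX : ∀ x ∈ J, x ∈ X ∧ x ∉ D ∧ dist y x = 1 := fun x hx =>
    ⟨(mem_sdiff.1 (mem_filter.1 hx).1).1, (mem_sdiff.1 (mem_filter.1 hx).1).2, (mem_filter.1 hx).2⟩
  have hnorm : ∀ x ∈ J, ‖L.symm (x - y)‖ = 1 := fun x hx => by
    rw [LinearIsometryEquiv.norm_map, ← dist_eq_norm, dist_comm]; exact (hJX x hx).2.2
  have hslot : ∀ x ∈ J, ∀ k ∈ lowerNine, k ≠ 0 → ⟪L.symm (x - y), slotSite k⟫_ℝ ≤ 1 / 2 := fun x hx k hk hk0 =>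
    inner_le_half_of_occupied hX L (norm_eq_one_of_mem_fccSlots (slotSite_mem k)) (hDX (hocc k hk hk0)) (hJX x hx).1 (hJX x hx).2.2
      fun h => (hJX x hx).2.1 (h ▸ hocc k hk hk0)
  have hsep : ∀ a ∈ J, ∀ b ∈ J, a ≠ b → ⟪L.symm (a - y), L.symm (b - y)⟫_ℝ ≤ 1 / 2 := fun a ha b hb hab =>
    inner_le_half_of_contacts hX L (hJX a ha).1 (hJX b hb).1 hab (hJX a ha).2.2 (hJX b hb).2.2
  -- split: tongue / heal-free
  have hsplit := Finset.card_filter_add_card_filter_not (s := J) (fun x => 1 / 2 < ⟪L.symm (x - y), slotSite 0⟫_ℝ)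
  -- at most one junk ball in the tongue
  have hT : (J.filter fun x => 1 / 2 < ⟪L.symm (x - y), slotSite 0⟫_ℝ).card ≤ 1 := by
    rw [card_le_one]
    intro a ha b hb
    by_contra hab
    obtain ⟨haJ, ha0⟩ := mem_filter.1 ha
    obtain ⟨hbJ, hb0⟩ := mem_filter.1 hb
    have hta : TongueDir (L.symm (a - y)) :=
      ⟨hnorm a haJ, hslot a haJ 4 (by decide) (by decide), hslot a haJ 9 (by decide) (by decide), hslot a haJ 5 (by decide) (by decide), ha0⟩
    have htb : TongueDir (L.symm (b - y)) :=
      ⟨hnorm b hbJ, hslot b hbJ 4 (by decide) (by decide), hslot b hbJ 9 (by decide) (by decide), hslot b hbJ 5 (by decide) (by decide), hb0⟩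
    linarith [inner_gt_half_of_tongue hta htb, hsep a haJ b hbJ hab]
  -- at most two heal-free junk balls
  have hC : (J.filter fun x => ¬ 1 / 2 < ⟪L.symm (x - y), slotSite 0⟫_ℝ).card ≤ 2 := by
    by_contra hlt
    rw [not_le] at hlt
    obtain ⟨a, ha, b, hb, e, he, hab, hae, hbe⟩ := two_lt_card.1 hlt
    have hfree : ∀ x ∈ J.filter (fun x => ¬ 1 / 2 < ⟪L.symm (x - y), slotSite 0⟫_ℝ), x ∈ J ∧ HealFree (L.symm (x - y)) := by
      intro x hx
      obtain ⟨hxJ, hx0⟩ := mem_filter.1 hx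
      refine ⟨hxJ, hnorm x hxJ, fun k hk => ?_⟩
      by_cases hk0 : k = 0
      · subst hk0; exact le_of_not_gt hx0
      · exact hslot x hxJ k hk hk0
    -- a heal-free junk tip is one of the two hollows over slot `0`
    have htip : ∀ x ∈ J, L.symm (x - y) ∈ healTips → L.symm (x - y) = slotSite 8 ∨ L.symm (x - y) = basalMirror (slotSite 5) := by
      intro x hxJ ht
      by_contra hne
      push Not at hne
      obtain ⟨hxX, hxD, hyx⟩ := hJX x hxJ
      have hxW : x ∈ X.filter fun x => dist z x ≤ 3 := mem_filter.2 ⟨hxX, by linarith [dist_triangle z y x]⟩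
      have hcap : CapsTriangleIn D x := by
        have := capsTriangleIn_of_tip_off_zero L hy hocc ht hne.1 hne.2
        rwa [LinearIsometryEquiv.apply_symm_apply, add_sub_cancel] at this
      exact hxD (mem_capClosure_of_capsTriangleIn (siteBallsAt_subset _ _ _) hxW hcap)
    obtain ⟨haJ, hfa⟩ := hfree a ha
    obtain ⟨hbJ, hfb⟩ := hfree b hb
    obtain ⟨heJ, hfe⟩ := hfree e he
    obtain ⟨ta, tb, te⟩ := healFree_three hfa hfb hfe (hsep a haJ b hbJ hab) (hsep a haJ e heJ hae) (hsep b hbJ e heJ hbe)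
    have hinj : ∀ p q : EuclideanSpace ℝ (Fin 3), L.symm (p - y) = L.symm (q - y) → p = q := fun p q h =>
      sub_left_injective (L.symm.injective h)
    rcases htip a haJ ta with h1 | h1 <;> rcases htip b hbJ tb with h2 | h2 <;> rcases htip e heJ te with h3 | h3
    · exact hab (hinj a b (h1.trans h2.symm))
    · exact hab (hinj a b (h1.trans h2.symm))
    · exact hae (hinj a e (h1.trans h3.symm))
    · exact hbe (hinj b e (h2.trans h3.symm))
    · exact hbe (hinj b e (h2.trans h3.symm))
    · exact hae (hinj a e (h1.trans h3.symm))
    · exact hab (hinj a b (h1.trans h2.symm))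
    · exact hab (hinj a b (h1.trans h2.symm))
  omega

/-! ### The pattern, for the table -/

/-- Pattern «hexagon − 1 + lower triple»: the positions `y + L(slot)` for `slot ∈ lowerNine ∖ {0}` are core balls (slot `0` is the empty hexagon slot; every
one-empty-hexagon-slot configuration is this one in a suitable frame). -/
def HexFivePat (L : EuclideanSpace ℝ (Fin 3) ≃ₗᵢ[ℝ] EuclideanSpace ℝ (Fin 3)) (D : Finset (EuclideanSpace ℝ (Fin 3))) (y : EuclideanSpace ℝ (Fin 3)) : Prop :=
  ∀ k ∈ lowerNine, k ≠ 0 → y + L (slotSite k) ∈ D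

open scoped Classical in
/-- **The row in the shape `junkCapBound_patternCap` consumes** (pattern hypothesis last). -/
theorem junk_contacts_le_three_of_hexFivePat (X : Finset (EuclideanSpace ℝ (Fin 3))) (hX : ∀ p ∈ X, ∀ q ∈ X, p ≠ q → 1 ≤ dist p q)
    (z : EuclideanSpace ℝ (Fin 3)) (_hz : z ∈ X) (S : EuclideanSpace ℝ (Fin 3) ≃ₗᵢ[ℝ] EuclideanSpace ℝ (Fin 3)) (y : EuclideanSpace ℝ (Fin 3))
    (hy : y ∈ coreOf X z S) (hzy : dist z y ≤ 2) (L : EuclideanSpace ℝ (Fin 3) ≃ₗᵢ[ℝ] EuclideanSpace ℝ (Fin 3)) (hL : HexFivePat L (coreOf X z S) y) :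
    ((X \ coreOf X z S).filter fun x => dist y x = 1).card ≤ 3 :=
  junk_contacts_le_three_of_hexFive hX S hy hzy L hL

end TailResidue

end Summit.Ventures.Crystal3D.Theorems

end
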